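import Literature.NumberTheory.EllipticCurves.CasselsTateLevelPrimary
import Literature.NumberTheory.EllipticCurves.ShaCorestrictionIndexTwo
import Literature.NumberTheory.GaloisCohomology.ArchimedeanInvariantMap
import Literature.NumberTheory.EllipticCurves.CasselsTateAutomorphismInvariance
import Literature.NumberTheory.EllipticCurves.TorsionPairingOrderThreeInvariant
import HarnessLib

/-!
# ★ The definition-level restriction/corestriction package of the Cassels–Tate pairing of the canonical
# invariant maps FROM CLAUSE (vii) ALONE (res/cor adjointness for THIS curve, level and pairings) — the
# `𝒪`-balance now a THEOREM (`pairing_omegaBalanced_of_weilInvariant`, [ζ]-invariance by transport)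

Topic `NumberTheory/EllipticCurves`; namespace `Literature.NumberTheory.EllipticCurves`. Theorems only: **no
definition, no named fact, no instance, no notation** (D-0026, net debt 0). Sequel of
`CasselsTateCanonicalResCorPackage.lean` (`exists_ctLevelPairing_resCor_package`, p703449), whose displayed input was
the whole named fact `casselsTate_canonical_adjoint K σ₀ h2 hσ₀` = (vi) isogeny-adjointness [Milne I Rem. 6.10(a)] ∧
(vii) res/cor-adjointness [Fisher 2003 Prop. 2.16]. Here clause (vi) is NO LONGER AN INPUT: the `𝒪`-balance of the
pinned pairing `B₂` on `Ш(E_K/K)[2^∞]` is the theorem `pairing_omegaBalanced_of_weilInvariant`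
(`CasselsTateAutomorphismInvariance.lean`: invariance of `ctGeneralFun` under the automorphism `φ` with `φ³ = id`
preserving the level-`m²` pairing, by two-sided transport of Milne's data). The remaining displayed pairing input is
`hvii` — clause (vii) SPECIALISED to this `W`, `m`, `eℚ`, `eK` (exactly what `hF.2 … hee` produced in the prequel) —
together with `hφ3 : φ³ = id` on `E_K(K̄)` (exported by `exists_cm_operator_galH1Torsion` as `φ² + φ + 1 = 0`);
the invariance `eK (φ S) (φ T) = eK S T` on `E_K[m²]` needed by the transport is the determinant lemma
`weilPairing_apply_isogeny_of_pow_three` (`TorsionPairingOrderThreeInvariant.lean`), no input.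
Seat `bsd-cm-k-ty1` (eleventh seating), planner D602 (2) / D607 ((K-c)(T3) sequel); helper of crux
`stmt-BirchSwinnertonDyer-19804` (`UpperOffV0HSYPlus`). Conclusion BYTE-IDENTICAL to the prequel's (the (CT-3′)
hypotheses `hrr`/`hrw`/[O] of `Summits/…/SylvesterTwoHeegnerIndexCoupledTelescopeLagrangian` for the SAME pinned
pairing). Nothing curve-specific is proved; no summit statement is proved or advanced by this file alone; BSD is not
claimed.

## References

* [Fisher2003] T. A. Fisher, *The Cassels–Tate pairing and the Platonic solids*, J. Number Theory 98
  (2003), Prop. 2.16 (p. 132).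
* [MilneADT2006] J. S. Milne, *Arithmetic Duality Theorems*, 2nd ed. (2006), Ch. I §6 Prop. 6.9,
  Rem. 6.10(a), Thm. 6.13(a).
* [SilvermanAEC2009] J. H. Silverman, *The Arithmetic of Elliptic Curves*, 2nd ed. (2009), III.6.1, III.8.2.
* [SerreGaloisCohomology1997] J.-P. Serre, *Galois Cohomology*, I.§2.4 Prop. 9.
-/

noncomputable section

open scoped Classical AddSubgroup

namespace Literature.NumberTheory.EllipticCurves

open Literature.GroupTheory.FiniteAbelian

/-! ## ★ The definition-level res/cor package from clause (vii) for this curve, with [O] a theorem -/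

section Package

open _root_.WeierstrassCurve Field NumberField Function
open Literature.NumberTheory.GaloisRepresentations Literature.NumberTheory.GaloisCohomology
open Literature.NumberTheory.GaloisRepresentations.DiscreteGaloisModule (mu MuCarrier)
open Literature.GroupTheory.FiniteAbelian

variable {K : Type} [Field K] [NumberField K] {σ₀ : K ≃ₐ[ℚ] K} {h2 : Module.finrank ℚ K = 2}
  {hσ₀ : σ₀ ≠ 1}

set_option maxHeartbeats 400000 in
/-- **★ The DEFINITION-LEVEL res/cor package from clause (vii) for THIS curve/level/pairings, with the
`𝒪`-balance a theorem.**  Same data and SAME conclusion as `exists_ctLevelPairing_resCor_package` (p703449), but the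
named fact `casselsTate_canonical_adjoint` is replaced by: `hvii` — res/cor adjointness of Milne's recipe on the two
canonical families for `a ∈ Ш(E/ℚ)[m]`, `c ∈ Ш(E_K/K)[m]` with `cor c ∈ Ш(E/ℚ)` (Fisher 2003 Prop. 2.16, the instance
the prequel obtained as `hF.2 … hee`) and `hφ3 : φ³ = id` (`φ` preserves `eK` on `E_K[m²]` by the determinant
lemma `weilPairing_apply_isogeny_of_pow_three`, Silverman III.8.2 with `deg φ = 1`). The `𝒪`-balance `B₂ (w a) b = B₂ a (w² b) = B₂ a (-b - w b)` is `pairing_omegaBalanced_of_weilInvariant`;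
`B₂ (res₂ a) (res₂ b) = 2 • Bℚ₂ a b` and `B₂ (res₂ a) (w (res₂ b)) = -(Bℚ₂ a b)` follow from `hvii` with
`cor ∘ res = 2` and `res ∘ cor = 1 + τ_*` exactly as in the prequel.
[cite: Fisher2003, Prop. 2.16 (JNT 98, p. 132)] [cite: MilneADT2006, Ch. I §6 Prop. 6.9, Rem. 6.10(a), Thm. 6.13(a)]
[cite: SilvermanAEC2009, Prop. III.8.2] [cite: SerreGaloisCohomology1997, I.§2.4 Prop. 9] -/
theorem exists_ctLevelPairing_resCor_package_of_resCor
    (W : WeierstrassCurve ℚ) [W.IsElliptic] [(W.baseChange K).IsElliptic] (m : ℕ) [NeZero m] {k : ℕ}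
    (hm : m = 2 ^ k)
    (eℚ : geomTorsion W ((m * m : ℕ) : ℤ) → geomTorsion W ((m * m : ℕ) : ℤ) → AlgebraicClosure ℚ)
    (hμ : ∀ S T, eℚ S T ^ (m * m) = 1)
    (hadd₁ : ∀ S₁ S₂ T, eℚ (S₁ + S₂) T = eℚ S₁ T * eℚ S₂ T)
    (hadd₂ : ∀ S T₁ T₂, eℚ S (T₁ + T₂) = eℚ S T₁ * eℚ S T₂)
    (hgal : ∀ (σ : absoluteGaloisGroup ℚ) (S T : geomTorsion W ((m * m : ℕ) : ℤ)),
      σ • eℚ S T = eℚ (σ • S) (σ • T))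
    (halt : ∀ T, eℚ T T = 1)
    (eK : geomTorsion (W.baseChange K) ((m * m : ℕ) : ℤ) →
      geomTorsion (W.baseChange K) ((m * m : ℕ) : ℤ) → AlgebraicClosure K)
    (hμK : ∀ S T, eK S T ^ (m * m) = 1)
    (hadd₁K : ∀ S₁ S₂ T, eK (S₁ + S₂) T = eK S₁ T * eK S₂ T)
    (hadd₂K : ∀ S T₁ T₂, eK S (T₁ + T₂) = eK S T₁ * eK S T₂)
    (hgalK : ∀ (σ : absoluteGaloisGroup K) (S T : geomTorsion (W.baseChange K) ((m * m : ℕ) : ℤ)),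
      σ • eK S T = eK (σ • S) (σ • T))
    (haltK : ∀ T, eK T T = 1)
    (hvii : ∀ (a : W.galH1) (c : (W.baseChange K).galH1), a ∈ W.sha → c ∈ (W.baseChange K).sha →
      (m : ℤ) • a = 0 → (m : ℤ) • c = 0 → corBaseChange K W σ₀ h2 hσ₀ c ∈ W.sha →
      ctGeneralFun (W.baseChange K) m eK hμK hadd₁K hadd₂K hgalK (LocalInvariants.canonical K (m * m))
          (resBaseChange W K a) c =
        ctGeneralFun W m eℚ hμ hadd₁ hadd₂ hgal (LocalInvariants.canonical ℚ (m * m)) a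
          (corBaseChange K W σ₀ h2 hσ₀ c))
    (hPT'ℚ : (LocalInvariants.canonical ℚ (m * m)).SumInvLocalizationEqZero)
    (hH3ℚ : ∀ c : galoisCohomology (mu ℚ (m * m)) 3,
      (∀ v : Place ℚ, galoisCohomology.localization (mu ℚ (m * m)) v 3 c = 0) → c = 0)
    (hfinℚ : ∀ D : GeneralCaseData W m eℚ hμ hadd₁ hadd₂ hgal, ∃ S : Finset (Place ℚ),
      ∀ v ∉ S, D.localTerm (LocalInvariants.canonical ℚ (m * m)) v = 0)
    (hPT'K : (LocalInvariants.canonical K (m * m)).SumInvLocalizationEqZero)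
    (hH3K : ∀ c : galoisCohomology (mu K (m * m)) 3,
      (∀ v : Place K, galoisCohomology.localization (mu K (m * m)) v 3 c = 0) → c = 0)
    (hfinK : ∀ D : GeneralCaseData (W.baseChange K) m eK hμK hadd₁K hadd₂K hgalK, ∃ S : Finset (Place K),
      ∀ v ∉ S, D.localTerm (LocalInvariants.canonical K (m * m)) v = 0)
    (hLPℚ : IsLevelPairing m (ctLevelPairing W m eℚ hμ hadd₁ hadd₂ hgal
      (LocalInvariants.canonical ℚ (m * m)) halt hPT'ℚ hH3ℚ hfinℚ))
    (hLPK : IsLevelPairing m (ctLevelPairing (W.baseChange K) m eK hμK hadd₁K hadd₂K hgalK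
      (LocalInvariants.canonical K (m * m)) haltK hPT'K hH3K hfinK))
    (hkℚ : ∀ x ∈ AddCommGroup.primaryComponent W.sha 2, 2 ^ k • x = 0)
    (hkK : ∀ x ∈ AddCommGroup.primaryComponent (W.baseChange K).sha 2, 2 ^ k • x = 0)
    (φ : Isogeny (W.baseChange K) (W.baseChange K)) (hφ3 : ∀ P, φ (φ (φ P)) = P)
    (w : AddCommGroup.primaryComponent (W.baseChange K).sha 2 →+
      AddCommGroup.primaryComponent (W.baseChange K).sha 2)
    (hw : ∀ x, (((w x : AddCommGroup.primaryComponent (W.baseChange K).sha 2) :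
        (W.baseChange K).sha) : (W.baseChange K).galH1) =
      galH1Map φ.toAddMonoidHom φ.equivariant ((x : (W.baseChange K).sha) : (W.baseChange K).galH1))
    (hwrel : ∀ x, w (w x) + w x + x = 0)
    {τ : AlgebraicClosure K ≃+* AlgebraicClosure K} (hτ : IsLiftOfAut σ₀ τ)
    (s : AddCommGroup.primaryComponent (W.baseChange K).sha 2 →+
      AddCommGroup.primaryComponent (W.baseChange K).sha 2)
    (hs : ∀ x, (((s x : AddCommGroup.primaryComponent (W.baseChange K).sha 2) :
        (W.baseChange K).sha) : (W.baseChange K).galH1) =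
      hτ.conjH1Points W ((x : (W.baseChange K).sha) : (W.baseChange K).galH1))
    (hsw : ∀ x, s (w x) = -(s x) - w (s x))
    (hinj : Function.Injective (resBaseChange W K)) :
    ∃ (Bℚ₂ : AddCommGroup.primaryComponent W.sha 2 →+ AddCommGroup.primaryComponent W.sha 2 →+
        AddCircle (1 : ℚ))
      (B₂ : AddCommGroup.primaryComponent (W.baseChange K).sha 2 →+
        AddCommGroup.primaryComponent (W.baseChange K).sha 2 →+ AddCircle (1 : ℚ))
      (res₂ : AddCommGroup.primaryComponent W.sha 2 →+
        AddCommGroup.primaryComponent (W.baseChange K).sha 2),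
      (∀ a b, Bℚ₂ a b = zmodToCircle (m * m) (ctGeneralFun W m eℚ hμ hadd₁ hadd₂ hgal
        (LocalInvariants.canonical ℚ (m * m)) ((a : W.sha) : W.galH1) ((b : W.sha) : W.galH1))) ∧
      (∀ a b, B₂ a b = zmodToCircle (m * m) (ctGeneralFun (W.baseChange K) m eK hμK hadd₁K hadd₂K hgalK
        (LocalInvariants.canonical K (m * m)) ((a : (W.baseChange K).sha) : (W.baseChange K).galH1)
        ((b : (W.baseChange K).sha) : (W.baseChange K).galH1))) ∧
      (∀ a, ((res₂ a : AddCommGroup.primaryComponent (W.baseChange K).sha 2) :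
        (W.baseChange K).sha) = shaRestriction W K a) ∧
      ((∀ a, Bℚ₂ a a = 0) ∧ (∀ a b, Bℚ₂ b a = -(Bℚ₂ a b)) ∧
        (∀ a, (∀ b, Bℚ₂ a b = 0) → a = 0) ∧ (∀ b, (∀ a, Bℚ₂ a b = 0) → b = 0)) ∧
      ((∀ a, B₂ a a = 0) ∧ (∀ a b, B₂ b a = -(B₂ a b)) ∧
        (∀ a b, B₂ (w a) b = B₂ a (w (w b))) ∧ (∀ a b, B₂ (w a) b = B₂ a (-b - w b)) ∧
        (∀ a, (∀ b, B₂ a b = 0) → a = 0) ∧ (∀ b, (∀ a, B₂ a b = 0) → b = 0)) ∧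
      (∀ a b, B₂ (res₂ a) (res₂ b) = 2 • Bℚ₂ a b) ∧
      (∀ a b, B₂ (res₂ a) (w (res₂ b)) = -(Bℚ₂ a b)) := by
  obtain ⟨hleℚ, Bℚ₂, -, hBℚ₂, hℚalt, hℚanti, hℚl, hℚr⟩ :=
    exists_primaryComponent_ctLevelPairing W m eℚ hμ hadd₁ hadd₂ hgal (LocalInvariants.canonical ℚ (m * m))
      halt hPT'ℚ hH3ℚ hfinℚ Nat.prime_two hm hLPℚ hkℚ
  obtain ⟨hleK, B₂, -, hBK₂, hKalt, hKanti, hKl, hKr⟩ :=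
    exists_primaryComponent_ctLevelPairing (W.baseChange K) m eK hμK hadd₁K hadd₂K hgalK
      (LocalInvariants.canonical K (m * m)) haltK hPT'K hH3K hfinK Nat.prime_two hm hLPK hkK
  -- the restriction on the 2-primary parts
  have hresmem : ∀ a : AddCommGroup.primaryComponent W.sha 2,
      shaRestriction W K a ∈ AddCommGroup.primaryComponent (W.baseChange K).sha 2 := fun a ↦ by
    obtain ⟨j, hj⟩ := (AddCommGroup.mem_primaryComponent (G := W.sha)).mp a.2
    have h := congrArg (shaRestriction W K) hj
    rw [map_nsmul, map_zero] at h
    exact (AddCommGroup.mem_primaryComponent (G := (W.baseChange K).sha)).mpr ⟨j, h⟩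
  obtain ⟨res₂, hres₂⟩ : ∃ res₂ : AddCommGroup.primaryComponent W.sha 2 →+
      AddCommGroup.primaryComponent (W.baseChange K).sha 2,
      ∀ a, ((res₂ a : AddCommGroup.primaryComponent (W.baseChange K).sha 2) :
        (W.baseChange K).sha) = shaRestriction W K a :=
    ⟨((shaRestriction W K).comp (AddCommGroup.primaryComponent W.sha 2).subtype).codRestrict _
      fun a ↦ hresmem a, fun _ ↦ rfl⟩
  have hres₂' : ∀ a : AddCommGroup.primaryComponent W.sha 2,
      (((res₂ a : AddCommGroup.primaryComponent (W.baseChange K).sha 2) : (W.baseChange K).sha) :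
        (W.baseChange K).galH1) = resBaseChange W K ((a : W.sha) : W.galH1) := fun a ↦ by
    rw [hres₂, coe_shaRestriction_apply]
  -- torsion bookkeeping
  have htorℚ : ∀ x : AddCommGroup.primaryComponent W.sha 2,
      (m : ℤ) • (((x : AddCommGroup.primaryComponent W.sha 2) : W.sha) : W.galH1) = 0 := by
    intro x
    have h := congrArg (fun z : W.sha ↦ (z : W.galH1)) (hkℚ x.1 x.2)
    have h' : (2 ^ k : ℕ) • (((x : AddCommGroup.primaryComponent W.sha 2) : W.sha) : W.galH1) = 0 := by
      simpa only [AddSubgroupClass.coe_nsmul, ZeroMemClass.coe_zero] using h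
    rw [hm, natCast_zsmul]
    exact h'
  have htorK : ∀ x : AddCommGroup.primaryComponent (W.baseChange K).sha 2,
      (m : ℤ) • (((x : AddCommGroup.primaryComponent (W.baseChange K).sha 2) : (W.baseChange K).sha) :
        (W.baseChange K).galH1) = 0 := by
    intro x
    have h := congrArg (fun z : (W.baseChange K).sha ↦ (z : (W.baseChange K).galH1)) (hkK x.1 x.2)
    have h' : (2 ^ k : ℕ) • (((x : AddCommGroup.primaryComponent (W.baseChange K).sha 2) :
        (W.baseChange K).sha) : (W.baseChange K).galH1) = 0 := by
      simpa only [AddSubgroupClass.coe_nsmul, ZeroMemClass.coe_zero] using h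
    rw [hm, natCast_zsmul]
    exact h'
  -- Ш-level form of `hw` and the 𝒪-balance from [ζ]-invariance (a theorem)
  have hw' : ∀ x, ((w x : AddCommGroup.primaryComponent (W.baseChange K).sha 2) :
      (W.baseChange K).sha) =
      shaMap φ.toAddMonoidHom φ.equivariant φ.hasLocalPointsMaps_toAddMonoidHom x := fun x ↦ by
    apply Subtype.ext
    rw [hw, coe_shaMap_apply]
  -- `[ζ]` preserves `eK` on `E_K[m²]`: the determinant lemma (`TorsionPairingOrderThreeInvariant`)
  have heφ := weilPairing_apply_isogeny_of_pow_three (W.baseChange K) m hm eK hμK hadd₁K hadd₂K haltK φ hφ3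
  have hbal := fun a b ↦ pairing_omegaBalanced_of_weilInvariant (W.baseChange K) m eK hμK hadd₁K hadd₂K hgalK
    (LocalInvariants.canonical K (m * m)) φ hφ3 heφ haltK hPT'K (zmodToCircle (m * m)) B₂ hBK₂ w hw' hwrel a b
  -- consequence 1: `B₂ (res a) (res b) = 2 • Bℚ₂ a b`
  have hc1 : ∀ a b : AddCommGroup.primaryComponent W.sha 2, B₂ (res₂ a) (res₂ b) = 2 • Bℚ₂ a b :=
    fun a b ↦ by
    have hcmem : corBaseChange K W σ₀ h2 hσ₀ (resBaseChange W K ((b : W.sha) : W.galH1)) ∈ W.sha := by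
      rw [← coe_shaRestriction_apply]
      exact corBaseChange_shaRestriction_mem K W σ₀ h2 hσ₀ _
    have hcm : (m : ℤ) • resBaseChange W K ((b : W.sha) : W.galH1) = 0 := by
      rw [← map_zsmul, htorℚ b, map_zero]
    rw [hBK₂, hres₂' a, hres₂' b,
      hvii _ _ (a : W.sha).2 (by rw [← coe_shaRestriction_apply]; exact (shaRestriction W K _).2) (htorℚ a) hcm hcmem,
      corBaseChange_resBaseChange]
    rw [show (2 • ((b : W.sha) : W.galH1)) =
        (((2 • b : AddCommGroup.primaryComponent W.sha 2) : W.sha) : W.galH1) by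
      simp only [AddSubgroupClass.coe_nsmul], ← hBℚ₂, map_nsmul]
  -- consequence 2: `c = w (res b)` satisfies `c + τ_* c = res (−b)`, so `cor c = −b`
  have hc2 : ∀ a b : AddCommGroup.primaryComponent W.sha 2,
      B₂ (res₂ a) (w (res₂ b)) = -(Bℚ₂ a b) := fun a b ↦ by
    have hsres : s (res₂ b) = res₂ b := by
      apply Subtype.ext; apply Subtype.ext
      rw [hs, hres₂, conjH1Points_shaRestriction]
    have key : w (res₂ b) + s (w (res₂ b)) = -(res₂ b) := by rw [hsw, hsres]; abel
    have key' := congrArg (fun z : AddCommGroup.primaryComponent (W.baseChange K).sha 2 ↦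
      ((z : (W.baseChange K).sha) : (W.baseChange K).galH1)) key
    simp only [AddMemClass.coe_add, NegMemClass.coe_neg] at key'
    rw [hs (w (res₂ b)), hres₂' b, ← map_neg] at key'
    have hcor : corBaseChange K W σ₀ h2 hσ₀ (((w (res₂ b) : AddCommGroup.primaryComponent
        (W.baseChange K).sha 2) : (W.baseChange K).sha) : (W.baseChange K).galH1) =
        -((b : W.sha) : W.galH1) :=
      hinj (by rw [resBaseChange_corBaseChange K W σ₀ h2 hσ₀ hτ, key'])
    have hcmem : corBaseChange K W σ₀ h2 hσ₀ (((w (res₂ b) : AddCommGroup.primaryComponent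
        (W.baseChange K).sha 2) : (W.baseChange K).sha) : (W.baseChange K).galH1) ∈ W.sha := by
      rw [hcor]; exact W.sha.neg_mem (b : W.sha).2
    rw [hBK₂, hres₂' a,
      hvii _ _ (a : W.sha).2
        ((w (res₂ b) : AddCommGroup.primaryComponent (W.baseChange K).sha 2) : (W.baseChange K).sha).2
        (htorℚ a) (htorK _) hcmem,
      hcor]
    rw [show (-((b : W.sha) : W.galH1)) =
        (((-b : AddCommGroup.primaryComponent W.sha 2) : W.sha) : W.galH1) by
      simp only [NegMemClass.coe_neg], ← hBℚ₂, map_neg]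
  exact ⟨Bℚ₂, B₂, res₂, hBℚ₂, hBK₂, hres₂, ⟨hℚalt, hℚanti, hℚl, hℚr⟩,
    ⟨hKalt, hKanti, fun a b ↦ (hbal a b).2.1, fun a b ↦ (hbal a b).2.2, hKl, hKr⟩, hc1, hc2⟩

end Package

end Literature.NumberTheory.EllipticCurves

end
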